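import Mathlib
import Literature.MathematicalPhysics.QuantumFieldTheory.Balaban1983to89.B16TstarCount
import Literature.MathematicalPhysics.QuantumFieldTheory.Balaban1983to89.B7BlockGeometry
import Literature.MathematicalPhysics.QuantumFieldTheory.Balaban1983to89.B10Eq20Locality

/-!
# `Balaban1983to89.B13CorridorSeparation` — the corridor bond `b₀(c)` of [I] p. 267 SEPARATES the dependence
sets `B(c₋) ∪ B(c₊)`: `b₀(c′) ⊂ B(c₋) ∪ B(c₊) ⇒ c′ = c`, on the two block geometries of the tree, and the
hypotheses `hb` / `hsep` of `B13PkLocalTerms` §1b and `B10Eq20Locality` §3–§4 DISCHARGED BY NAME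

CITATION HEADER (lean-in-tree rule 2026-08-18).  Sources, all held; the quotations were READ AS IMAGES on the x2
page renders of the cell (`run/shared/lean/pub/pub-balaban/b2b-balaban-ref1/pages/…`), not on an OCR layer:
(B12 = [I]) T. Bałaban, *Renormalization group approach to lattice gauge field theories. I. Generation of effective
actions in a small field approximation and a coupling constant renormalization in four dimensions*, Commun. Math.
Phys. **109**, 249–301 (1987), doi:10.1007/bf01215223, bib `Balaban1987RG1` (`paper:balaban1987-cmp109-rg-i-small-field`;
journal page = PDF page + 248; render `1987-cmp109-rg-I-small-field-p019-x2.png` = p. 267);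
(B10) T. Bałaban, *Ultraviolet stability of three-dimensional lattice pure gauge field theories*, Commun. Math.
Phys. **102**, 255–275 (1985), doi:10.1007/bf01229380, bib `Balaban1985UV3` (`paper:balaban1985-cmp102-uv-stability-3d`;
journal page = PDF page + 254; render `1985-cmp102-uv-stability-3d-p006-x2.png` = p. 260);
(B7) T. Bałaban, *Averaging operations for lattice gauge theories*, Commun. Math. Phys. **98**, 17–51 (1985),
doi:10.1007/bf01211042, bib `Balaban1985Averaging` (`paper:balaban1985-cmp98-averaging`; journal page = PDF page
+ 16; renders `1985-cmp98-averaging-p022-x2.png` = p. 38, `…-p015-x2.png` = p. 31);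
(B13 = [II]) T. Bałaban, *Renormalization group approach to lattice gauge field theories. II. Cluster expansions*,
Commun. Math. Phys. **116**, 1–22 (1988), doi:10.1007/bf01239022, bib `Balaban1988RG2Cluster` (the paper under
audit in this sub-cell, which takes the objects below over from [I] Sect. 2; it is NOT cited for any step).

* [I] p. 267 [PDF 19], after (2.10): *"The function hB is equal to 0 everywhere, except the set
  {b₀(c) : c ∈ T⁽ᵏ⁺¹⁾}. [Let us recall that for c ∈ T⁽ᵏ⁺¹⁾ the bond b₀(c) is defined as the bond of the lattice T⁽ᵏ⁾
  contained in c and belonging to the corridor B(c) = {b ∈ T⁽ᵏ⁾ : b₋ ∈ B(c₋), b₊ ∈ B(c₊)}.] Furthermore, the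
  operator h satisfies the identity LQ̃h = I on T⁽ᵏ⁺¹⁾. Of course h is uniquely defined by these conditions, in fact
  it is a very simple operator given by the equality (hB)(b₀(c)) = h(c)B(c), … We are looking for an analytic,
  g-valued function D̃(B′), defined at bonds of T⁽ᵏ⁺¹⁾, and such that the transformation B′ = B − hD̃(B) linearizes
  the function Q̃(B′)."*
* [B10] p. 260 [PDF 6], after (17) `QD̃(A, c) = C(A − D̃(A, c), c)`: *"Let us denote by b₀(c) the bond b ∈ B(c) and
  contained in c (let us recall that B(c) is the set of bonds connecting the blocks B(c₋), B(c₊), i.e. the set of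
  bonds b such that b₋ ∈ B(c₋), b₊ ∈ B(c₊)). We assume that D̃(A, b, c) = 0 for all b ≠ b₀(c). This assures the
  locality properties."* and, same page: *"The function D̃(A, c), similarly as Q(A′, c), depends on A restricted
  to B(c₋) ∪ B(c₊). It is this locality property which simplifies analysis of interaction terms in the integrals."*
* [B7] Proposition 4, p. 38 [PDF 22]: *"There exist constants C₂, c₄ such that for α₀, α₁ ≦ c₄ the function
  Q_k(U₀, ηA, c) = (1/i) log(Ū₁ᵏ)_c, c ⊂ Ω⁽ᵏ⁾, is an analytic function of the variables A_b, b ⊂ Bᵏ(c₋) ∪ Bᵏ(c₊).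
  Further we have Q_k(U₀, ηA) = Q_k(U₀)A + C_k(U₀, A), (134) and |C_k(U₀, A)| ≦ C₂|A|² < C₂α₁². (135)"*;
  p. 31 [PDF 15]: *"Let us remark that these averages have the same locality properties as the averages Ūᵏ,
  namely (Ūᵏ)_c, c ⊂ Ω⁽ᵏ⁾, depends on the variables U_b for b ⊂ Bᵏ(c₋) ∪ Bᵏ(c₊)."*

WHAT THIS MODULE DOES (audit cell `pub-balaban`, unit `b2b-balaban-b13-g11` = PAPER SUB-CELL B13 gen 11, journal
claim `G-adv9-20-SEP-GEOMETRY`; value = a KERNEL CERTIFICATE of two printed-geometry lines, NOT summit progress;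
nothing of the series is asserted).  `B13PkLocalTerms` §1b (the fixed-point map `D ↦ C̃(B − hD)` of [I] p. 267) and
its consumer `B10Eq20Locality` (the determinant factorisation (20) of [B10]) carry, as HYPOTHESES never discharged
there, `hb : Function.Injective b₀` and the SEPARATION `hsep : ∀ c c′, c ≠ c′ → b₀ c′ ∉ N c` of the distinguished
bonds from the dependence sets `N c` of `C̃(·)(c)` — in print `N(c)` = the bonds `b ⊂ B(c₋) ∪ B(c₊)` ([B7] Prop. 4,
[B10] p. 260; cell GAPS rows G-adv9-20 (b), G-adv9-44, C-B13-23: «located, not formalised»).  Here both are PROVED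
on the block geometries already in the tree, and the cited theorems are re-exported with them discharged:

* §1 — ONE ABSTRACT LEMMA.  Over a block map `blk : Site → CSite` with fine / coarse unit vectors `eF`, `eC`
  (bonds indexed `b = (x, μ) = ⟨x, x + e_μ⟩`, `B16TstarCount.Bond`): the dependence set
  `depSet c = {b : blk b₋ ∈ {c₋, c₊} ∧ blk b₊ ∈ {c₋, c₊}}` (*"b ⊂ B(c₋) ∪ B(c₊)"*, both endpoints in the two blocks —
  the reading of `B7BlockGeometry.bondsIn` / `qppBonds`) and the corridor `corr c = {b : blk b₋ = c₋, blk b₊ = c₊}`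
  ([I] p. 267).  If the coarse unit vectors satisfy `e_μ ≠ 0`, `e_μ + e_ν ≠ 0`, `μ ↦ e_μ` injective (`Separating eC`),
  then A CORRIDOR BOND OF `c′` LYING IN `depSet c` FORCES `c′ = c` (`eq_of_mem_corr_of_mem_depSet`: the block indices
  `y′`, `y′ + e_μ′` of its endpoints both lie in `{y, y + e_μ}`, and the four cases leave only `y′ = y`, `e_μ′ = e_μ` —
  `eq_and_eq_of_mem_pair`).  Hence for ANY choice `b0 c ∈ corr c` of corridor bonds: `b0` is injective
  (`injective_of_mem_corr`), `b0 c ∈ depSet c`, and `c ≠ c′ → b0 c′ ∉ depSet c` (`not_mem_depSet_of_ne`) — exactly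
  the shape of `hsep`.
* §2 — THE PERIODIC LATTICE of `B16TstarCount` §2 (fine `(ℤ/n)ᵈ`, coarse `(ℤ/m)ᵈ`, `n = L·m`, `L`-blocks of offset
  `h < L`, the explicit `b0 L n h c` proved THERE to be the printed `b₀(c)`: `b0_mem_corridor`,
  `eq_b0_of_mem_corridor`).  `cUnit m` is `Separating` iff the coarse torus has `m ≥ 3` sites per direction
  (`separating_cUnit`; `2·e_μ ≠ 0` is the binding condition), so for `2 < m`: `b0 c′ ∈ depSet c → c′ = c`
  (`torus_eq_of_b0_mem_depSet`), the `hsep` shape (`torus_b0_not_mem_depSet_of_ne`).  TIGHTNESS: with `m = 2` the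
  separation FAILS for every `L`, `h`, `d ≥ 1` (`torus_not_separated_two`: `c′ = ⟨y + e_μ, y + 2e_μ⟩ = ⟨y + e_μ, y⟩ ≠ c`
  has `b₀(c′) ⊂ B(c₊) ∪ B(c₋)`), so the hypothesis `2 < m` is sharp; it holds on every coarse torus with at least
  three sites per direction (the series' tori: [I] p. 251 and the header of `B16TstarCount`; no count of the series'
  lattices is asserted here).
* §3 — THE CORNER-CUBE GEOMETRY ON `ℤᵈ` of `QuantumLattice.BalabanRG` / `B7BlockGeometry` (ratio `M ≥ 1`,
  `blockMap M x = ⌊x/M⌋`, coarse bond `c = (y, μ)` represented by the straight contour `blockLine M c` of `M` fine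
  bonds): `b0Z M c := (M·y + (M − 1)e_μ, μ)`, the last bond of `blockLine M c`, lies in the corridor
  (`b0Z_mem_corr`) and is the ONLY bond of `blockLine M c` that does (`eq_b0Z_of_mem_blockLine`: existence and
  uniqueness of the printed `b₀(c)` on this geometry, no size condition); the dependence set IS
  `B7BlockGeometry.qppBonds M c` (*"b ⊂ Bᵏ(c₋) ∪ Bᵏ(c₊)"*, (140)–(141) p. 39 of [B7]) — `mem_depSet_iff_mem_qppBonds`
  — and `b0Z M c′ ∈ qppBonds M c → c′ = c` (`eq_of_b0Z_mem_qppBonds`), `b0Z` injective, the `hsep` shape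
  (`b0Z_not_mem_qppBonds_of_ne`).
* §4 — DISCHARGE BY NAME.  With `N c := depSet … c` (torus, `2 < m`) resp. `N c := ↑(qppBonds M c)` (`ℤᵈ`,
  `0 < M`) and `b₀ := b0 L n h` resp. `b0Z M`, the hypotheses `hb`, `hsep` of
  `B13PkLocalTerms.isLocalIn_fpMap` / `fixedPt_fpMap_apply_eq` and of `B10Eq20Locality.isCoarseLocal_of_dependsOn` /
  `eq20_of_fixedPt` are theorems; the re-exported statements (`isLocalIn_fpMap_torus`, `fixedPt_fpMap_apply_eq_torus`,
  `isCoarseLocal_of_dependsOn_torus`, `eq20_of_fixedPt_torus`; `isLocalIn_fpMap_zd`, `fixedPt_fpMap_apply_eq_zd`,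
  `isCoarseLocal_of_dependsOn_zd`) keep as binders ONLY the printed inputs: the locality of `C̃(·)(c)` in the
  variables on `B(c₋) ∪ B(c₊)` ([B7] Prop. 4 — `hCt` / `hN`), existence and uniqueness of the fixed point ([B10]
  p. 260 *"There exists a unique solution D̃ of this equation for A sufficiently small"* — `hfix`, `huniq`), and the
  differentiability point (`hL`).  (20) itself needs finitely many bonds, so its discharged form is stated on the
  torus only; on `ℤᵈ` the locality statements are.

SCOPE, stated honestly.  The corridor bond is read, as in `B16TstarCount`, through bonds indexed (initial point,
direction); *"b ⊂ B(c₋) ∪ B(c₊)"* is read as "both endpoints in `B(c₋) ∪ B(c₊)`" (the reading of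
`B7BlockGeometry.bondsIn`, [B7] p. 18); the blocks are the offset-`h` blocks of `B16TstarCount` on the torus (the
series: `L` odd, `h = (L − 1)/2`, centred cubes (0.3) [I] p. 252) and the corner cubes of `QuantumLattice.BalabanRG` on
`ℤᵈ` ([B7] (2) p. 17 up to a translation).  Which operator `C̃` of the series has WHICH dependence set is not decided
here: the dependence set is the binder `hCt` / `hN`, to be fed with [B7] Prop. 4 (itself a located leaf of the cell,
not re-proved).  Nothing here touches a disputed step: `b₀`, the corridor and `B(c₋) ∪ B(c₊)` are DEFINITIONS, and
the separation is reader's finite geometry proved in the kernel.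

DIVERGENCES from print (cell DIVERGENCE.md D-b13.20): bonds = (site, direction) pairs, `b₊ := b₋ + e_μ` (print:
intervals of the lattice, [I] p. 251); blocks through a block-index map `blk` (print: cubes `Bᵏ(y)`, (0.3));
`depSet` / `qppBonds` = endpoint reading of *"b ⊂"*; the torus needs `m ≥ 3` coarse sites per direction for the
separation (print: always satisfied, never stated); on `ℤᵈ` corner cubes replace centred cubes.

ABSOLUTE RULE.  No internally-minted statement enters as a cited fact: every `theorem` below is kernel-proved from
Mathlib and the imported tree modules; `[cite: …]` tags mark DEFINITIONS transcribing printed ones and theorems whose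
STATEMENT is a printed sentence with its located hypotheses discharged; the papers' disputed steps are not used.
Companion records: GAPS row C-B13-24 (+ UPDATE lines on G-adv9-20 / G-adv9-44 / C-B13-23), DIVERGENCE D-b13.20,
journal CLAIMS.log `G-adv9-20-SEP-GEOMETRY`, HANDOFF.md § b2b-balaban-b13 gen 11.
-/

namespace Literature.MathematicalPhysics.QuantumFieldTheory.Balaban1983to89

namespace B13CorridorSeparation

open B16TstarCount (Bond blk fUnit cUnit fineBond b0 corridor)

/-! ## §1  The abstract separation lemma -/

section Algebra

/-- The four-case lemma: if `y′ ∈ {y, y + e}` and `y′ + e′ ∈ {y, y + e}` with `e′ ≠ 0` and `e + e′ ≠ 0`, then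
`y′ = y` and `e′ = e`. [folklore] -/
theorem eq_and_eq_of_mem_pair {Y : Type*} [AddCancelCommMonoid Y] {y y' e e' : Y} (he' : e' ≠ 0)
    (hee' : e + e' ≠ 0) (h1 : y' = y ∨ y' = y + e) (h2 : y' + e' = y ∨ y' + e' = y + e) :
    y' = y ∧ e' = e := by
  rcases h1 with rfl | rfl
  · rcases h2 with h | h
    · exact absurd (by simpa using h) he'
    · exact ⟨rfl, add_left_cancel h⟩
  · rcases h2 with h | h
    · rw [add_assoc] at h
      exact absurd (by simpa using h) hee'
    · exact absurd (by simpa using h) he'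

end Algebra

section Blocked

variable {Site CSite : Type*} {d : ℕ} [Add Site] [AddCancelCommMonoid CSite]

/-- **The dependence set `N(c)` = the bonds `b ⊂ B(c₋) ∪ B(c₊)`** of [B7] Prop. 4 p. 38 / [B10] p. 260 (both
endpoints `b₋ = x`, `b₊ = x + e_μ` of `b = (x, μ)` have block index `c₋ = y` or `c₊ = y + e_μ`, `c = (y, μ)`), over an
abstract block map `blk` and unit vectors `eF` (fine), `eC` (coarse). [cite: Balaban1985Averaging, Prop.4 p.38] -/
def depSet (blk : Site → CSite) (eF : Fin d → Site) (eC : Fin d → CSite) (c : Bond CSite d) : Set (Bond Site d) :=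
  {b | (blk b.1 = c.1 ∨ blk b.1 = c.1 + eC c.2) ∧
    (blk (b.1 + eF b.2) = c.1 ∨ blk (b.1 + eF b.2) = c.1 + eC c.2)}

/-- **The corridor `B(c) = {b : b₋ ∈ B(c₋), b₊ ∈ B(c₊)}`** of [I] p. 267 over an abstract block map (on the torus
of §2 it is `B16TstarCount.corridor`, `corr_eq_corridor`). [cite: Balaban1987RG1, p.267] -/
def corr (blk : Site → CSite) (eF : Fin d → Site) (eC : Fin d → CSite) (c : Bond CSite d) : Set (Bond Site d) :=
  {b | blk b.1 = c.1 ∧ blk (b.1 + eF b.2) = c.1 + eC c.2}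

variable {blk : Site → CSite} {eF : Fin d → Site} {eC : Fin d → CSite}

/-- Membership in `depSet`. [folklore] -/
theorem mem_depSet {c : Bond CSite d} {b : Bond Site d} :
    b ∈ depSet blk eF eC c ↔ (blk b.1 = c.1 ∨ blk b.1 = c.1 + eC c.2) ∧
      (blk (b.1 + eF b.2) = c.1 ∨ blk (b.1 + eF b.2) = c.1 + eC c.2) :=
  Iff.rfl

/-- Membership in `corr`. [folklore] -/
theorem mem_corr {c : Bond CSite d} {b : Bond Site d} :
    b ∈ corr blk eF eC c ↔ blk b.1 = c.1 ∧ blk (b.1 + eF b.2) = c.1 + eC c.2 :=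
  Iff.rfl

/-- The corridor of `c` lies in `B(c₋) ∪ B(c₊)`. [folklore] -/
theorem corr_subset_depSet (c : Bond CSite d) : corr blk eF eC c ⊆ depSet blk eF eC c :=
  fun _ hb => ⟨Or.inl hb.1, Or.inr hb.2⟩

/-- The three conditions on the coarse unit vectors under which corridors separate: `e_μ ≠ 0`, `e_μ + e_ν ≠ 0`,
`μ ↦ e_μ` injective (on `(ℤ/m)ᵈ`: `m ≥ 3`, `separating_cUnit`; on `ℤᵈ`: always, `separating_single`). A READER'S
predicate. [folklore] -/
structure Separating (eC : Fin d → CSite) : Prop where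
  /-- `e_μ ≠ 0`. -/
  ne_zero : ∀ μ, eC μ ≠ 0
  /-- `e_μ + e_ν ≠ 0`. -/
  add_ne_zero : ∀ μ ν, eC μ + eC ν ≠ 0
  /-- `μ ↦ e_μ` is injective. -/
  injective : Function.Injective eC

/-- **SEPARATION (abstract form).**  A corridor bond of `c′` lying in `B(c₋) ∪ B(c₊)` forces `c′ = c`. [folklore] -/
theorem eq_of_mem_corr_of_mem_depSet (hS : Separating eC) {c c' : Bond CSite d} {b : Bond Site d}
    (hb : b ∈ corr blk eF eC c') (hbc : b ∈ depSet blk eF eC c) : c' = c := by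
  obtain ⟨h1, h2⟩ := hbc
  rw [hb.1] at h1
  rw [hb.2] at h2
  obtain ⟨hy, he⟩ := eq_and_eq_of_mem_pair (hS.ne_zero _) (hS.add_ne_zero _ _) h1 h2
  exact Prod.ext hy (hS.injective he)

/-- Distinct coarse bonds have disjoint corridors. [folklore] -/
theorem disjoint_corr (hS : Separating eC) {c c' : Bond CSite d} (hcc' : c ≠ c') :
    Disjoint (corr blk eF eC c) (corr blk eF eC c') :=
  Set.disjoint_left.2 fun _ hb hb' => hcc' (eq_of_mem_corr_of_mem_depSet hS hb (corr_subset_depSet _ hb'))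

variable {b0 : Bond CSite d → Bond Site d}

/-- For ANY choice of corridor bonds `b0 c ∈ B(c)`: `b0 c′ ⊂ B(c₋) ∪ B(c₊) ⇒ c′ = c`. [folklore] -/
theorem eq_of_b0_mem_depSet (hS : Separating eC) (hcorr : ∀ c, b0 c ∈ corr blk eF eC c) {c c' : Bond CSite d}
    (h : b0 c' ∈ depSet blk eF eC c) : c' = c :=
  eq_of_mem_corr_of_mem_depSet hS (hcorr c') h

/-- `b0 c ⊂ B(c₋) ∪ B(c₊)`. [folklore] -/
theorem b0_mem_depSet (hcorr : ∀ c, b0 c ∈ corr blk eF eC c) (c : Bond CSite d) : b0 c ∈ depSet blk eF eC c :=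
  corr_subset_depSet c (hcorr c)

/-- **The hypothesis `hsep` of `B13PkLocalTerms.isLocalIn_fpMap` / `B10Eq20Locality.isCoarseLocal_of_dependsOn`**:
no foreign distinguished bond `b0 c′`, `c′ ≠ c`, lies in `B(c₋) ∪ B(c₊)`. [folklore] -/
theorem not_mem_depSet_of_ne (hS : Separating eC) (hcorr : ∀ c, b0 c ∈ corr blk eF eC c) :
    ∀ c c', c ≠ c' → b0 c' ∉ depSet blk eF eC c :=
  fun _ _ hcc' h => hcc' (eq_of_b0_mem_depSet hS hcorr h).symm

/-- **The hypothesis `hb`**: a choice of corridor bonds is injective. [folklore] -/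
theorem injective_of_mem_corr (hS : Separating eC) (hcorr : ∀ c, b0 c ∈ corr blk eF eC c) :
    Function.Injective b0 :=
  fun c c' h => (eq_of_b0_mem_depSet hS hcorr (c := c) (c' := c') (h ▸ b0_mem_depSet hcorr c)).symm

end Blocked

/-! ## §2  The periodic lattice of `B16TstarCount` §2: separation iff `m ≥ 3` -/

section Torus

variable {d n m : ℕ}

/-- On the torus the abstract corridor is `B16TstarCount.corridor`. [folklore] -/
theorem corr_eq_corridor (L h : ℕ) (c : Bond (Fin d → ZMod m) d) :
    corr (blk (n := n) L m h) (fUnit n) (cUnit m) c = corridor (n := n) L m h c :=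
  rfl

/-- `(2 : ℤ/m) ≠ 0` for `m ≥ 3`. [folklore] -/
theorem two_ne_zero_of_lt (hm : 2 < m) : (2 : ZMod m) ≠ 0 := by
  intro h2
  have hv := ZMod.val_natCast (n := m) 2
  rw [Nat.cast_ofNat, h2, ZMod.val_zero, Nat.mod_eq_of_lt hm] at hv
  exact absurd hv (by norm_num)

/-- `(1 : ℤ/m) ≠ 0` for `m ≥ 2`. [folklore] -/
theorem one_ne_zero_of_lt (hm : 1 < m) : (1 : ZMod m) ≠ 0 := by
  haveI : Fact (1 < m) := ⟨hm⟩
  exact one_ne_zero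

/-- The coarse unit vectors of `(ℤ/m)ᵈ` are `Separating` as soon as `m ≥ 3`. [folklore] -/
theorem separating_cUnit (hm : 2 < m) : Separating (cUnit (d := d) m) := by
  have h1 : (1 : ZMod m) ≠ 0 := one_ne_zero_of_lt (by omega)
  have h2 : (2 : ZMod m) ≠ 0 := two_ne_zero_of_lt hm
  refine ⟨fun μ hμ => ?_, fun μ ν hμν => ?_, fun μ ν hμν => ?_⟩
  · have := congrFun hμ μ
    simp only [cUnit, ↓reduceIte, Pi.zero_apply] at this
    exact h1 this
  · have := congrFun hμν μ
    by_cases hνμ : μ = ν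
    · subst hνμ
      simp only [Pi.add_apply, cUnit, ↓reduceIte, Pi.zero_apply] at this
      exact h2 (by rw [← this]; norm_num)
    · simp only [Pi.add_apply, cUnit, ↓reduceIte, if_neg hνμ, add_zero, Pi.zero_apply] at this
      exact h1 this
  · by_contra hne
    have := congrFun hμν ν
    simp only [cUnit, if_neg (Ne.symm hne), ↓reduceIte] at this
    exact h1 this.symm

variable [NeZero m]

/-- `b0 c` lies in the (abstract = printed) corridor of `c` (`B16TstarCount.b0_mem_corridor`). [folklore] -/
theorem b0_mem_corr (L h : ℕ) (hn : n = L * m) (hh : h < L) (c : Bond (Fin d → ZMod m) d) :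
    b0 L n h c ∈ corr (blk (n := n) L m h) (fUnit n) (cUnit m) c :=
  B16TstarCount.b0_mem_corridor L h hn hh c

/-- **SEPARATION ON THE TORUS**: for `m ≥ 3` coarse sites per direction, `b₀(c′) ⊂ B(c₋) ∪ B(c₊) ⇒ c′ = c`.
[folklore] -/
theorem torus_eq_of_b0_mem_depSet (L h : ℕ) (hn : n = L * m) (hh : h < L) (hm : 2 < m)
    {c c' : Bond (Fin d → ZMod m) d} (hc : b0 L n h c' ∈ depSet (blk (n := n) L m h) (fUnit n) (cUnit m) c) :
    c' = c :=
  eq_of_b0_mem_depSet (separating_cUnit hm) (b0_mem_corr L h hn hh) hc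

/-- The `hsep` shape on the torus. [folklore] -/
theorem torus_b0_not_mem_depSet_of_ne (L h : ℕ) (hn : n = L * m) (hh : h < L) (hm : 2 < m) :
    ∀ c c' : Bond (Fin d → ZMod m) d, c ≠ c' → b0 L n h c' ∉ depSet (blk (n := n) L m h) (fUnit n) (cUnit m) c :=
  not_mem_depSet_of_ne (separating_cUnit hm) (b0_mem_corr L h hn hh)

/-- `b0 c ⊂ B(c₋) ∪ B(c₊)` on the torus. [folklore] -/
theorem torus_b0_mem_depSet (L h : ℕ) (hn : n = L * m) (hh : h < L) (c : Bond (Fin d → ZMod m) d) :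
    b0 L n h c ∈ depSet (blk (n := n) L m h) (fUnit n) (cUnit m) c :=
  b0_mem_depSet (b0_mem_corr L h hn hh) c

/-- Injectivity of `b0` on the torus (also `(B16TstarCount.b0Spec_torus …).injective`, any `m`). [folklore] -/
theorem torus_b0_injective (L h : ℕ) (hn : n = L * m) (hh : h < L) :
    Function.Injective (b0 (d := d) (m := m) L n h) :=
  (B16TstarCount.b0Spec_torus L h hn hh).injective

omit [NeZero m] in
/-- **TIGHTNESS: `m ≥ 3` cannot be weakened.**  With two coarse sites per direction (`m = 2`), for every `L`,
offset `h < L`, dimension and direction `μ`, the coarse bond `c′ = ⟨y + e_μ, y + 2e_μ⟩ = ⟨y + e_μ, y⟩ ≠ c = ⟨y, y + e_μ⟩`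
has `b₀(c′) ⊂ B(c₊) ∪ B(c₋)`: the separation fails. [folklore] -/
theorem torus_not_separated_two (L h : ℕ) (hn : n = L * 2) (hh : h < L) (y : Fin d → ZMod 2) (μ : Fin d) :
    ((y + cUnit 2 μ, μ) : Bond (Fin d → ZMod 2) d) ≠ (y, μ) ∧
      b0 L n h (y + cUnit 2 μ, μ) ∈ depSet (blk (n := n) L 2 h) (fUnit n) (cUnit 2) (y, μ) := by
  have h22 : cUnit (d := d) 2 μ + cUnit 2 μ = 0 := by
    funext ν
    simp only [Pi.add_apply, cUnit, Pi.zero_apply]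
    split_ifs
    · decide
    · simp
  refine ⟨fun hc => ?_, ?_⟩
  · have h1 := congrFun (congrArg Prod.fst hc) μ
    simp [cUnit] at h1
  · obtain ⟨hs, he⟩ := b0_mem_corr (m := 2) L h hn hh ((y + cUnit 2 μ, μ) : Bond (Fin d → ZMod 2) d)
    refine ⟨Or.inr hs, Or.inl ?_⟩
    rw [he, add_assoc, h22, add_zero]

end Torus

/-! ## §3  The corner-cube geometry on `ℤᵈ` of `B7BlockGeometry`: `b₀`, its uniqueness, and separation -/

section Zd

open Literature.MathematicalPhysics.QuantumLattice (ZdEdge blockMap blockBase blockLine mem_blockLine_iff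
  blockMap_blockBase blockMap_blockBase_add_of_lt)
open B7BlockGeometry (qppBonds mem_qppBonds twoBlocks mem_twoBlocks_iff blockMap_add_single_mul)

variable {d : ℕ}

/-- The unit vector `e_μ` of `ℤᵈ`. [folklore] -/
abbrev eZ (μ : Fin d) : Fin d → ℤ := Pi.single μ 1

/-- The unit vectors of `ℤᵈ` are `Separating` (no size condition). [folklore] -/
theorem separating_single : Separating (eZ (d := d)) := by
  refine ⟨fun μ hμ => ?_, fun μ ν hμν => ?_, fun μ ν hμν => ?_⟩
  · have := congrFun hμ μ
    simp at this
  · have := congrFun hμν μ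
    by_cases h : μ = ν
    · subst h
      simp only [Pi.add_apply, Pi.single_eq_same, Pi.zero_apply] at this
      omega
    · simp only [Pi.add_apply, Pi.single_eq_same, Pi.single_eq_of_ne h, Pi.zero_apply] at this
      omega
  · by_contra hne
    have := congrFun hμν μ
    simp only [Pi.single_eq_same, Pi.single_eq_of_ne hne] at this
    exact one_ne_zero this

/-- **`b₀(c)` on `ℤᵈ`**: for the coarse bond `c = (y, μ)` at ratio `M`, the fine bond `(M·y + (M − 1)e_μ, μ)` — the
last of the `M` bonds of the straight contour `blockLine M c` from the corner of `B(y)` to the corner of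
`B(y + e_μ)`, the one crossing from `B(c₋)` into `B(c₊)`. [cite: Balaban1987RG1, p.267] -/
def b0Z (M : ℕ) (c : ZdEdge d) : ZdEdge d := (blockBase M c.1 + Pi.single c.2 ((M : ℤ) - 1), c.2)

/-- `b0Z M c` is one of the bonds of the contour `blockLine M c` (*"contained in c"*). [folklore] -/
theorem b0Z_mem_blockLine {M : ℕ} (hM : 0 < M) (c : ZdEdge d) : b0Z M c ∈ blockLine M c := by
  rw [mem_blockLine_iff]
  refine ⟨M - 1, by omega, ?_⟩
  have : ((M - 1 : ℕ) : ℤ) = (M : ℤ) - 1 := by omega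
  rw [this]
  rfl

/-- `b0Z M c₋ ∈ B(c₋)`. [folklore] -/
theorem blockMap_b0Z_fst {M : ℕ} (hM : 0 < M) (c : ZdEdge d) : blockMap M (b0Z M c).1 = c.1 := by
  refine blockMap_blockBase_add_of_lt M c.1 _ (fun i => ?_) (fun i => ?_)
  · by_cases hi : i = c.2
    · subst hi; simp only [Pi.single_eq_same]; omega
    · simp only [Pi.single_eq_of_ne hi]; rfl
  · by_cases hi : i = c.2
    · subst hi; simp only [Pi.single_eq_same]; omega
    · simp only [Pi.single_eq_of_ne hi]; exact_mod_cast hM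

/-- `b0Z M c₊ ∈ B(c₊)`. [folklore] -/
theorem blockMap_b0Z_snd {M : ℕ} (hM : 0 < M) (c : ZdEdge d) :
    blockMap M ((b0Z M c).1 + eZ (b0Z M c).2) = c.1 + eZ c.2 := by
  haveI : NeZero M := ⟨hM.ne'⟩
  have h1 : (b0Z M c).1 + eZ (b0Z M c).2 = blockBase M c.1 + Pi.single c.2 ((M : ℤ) * 1) := by
    simp only [b0Z, eZ, add_assoc, ← Pi.single_add, mul_one, sub_add_cancel]
  rw [h1, blockMap_add_single_mul M hM.ne' _ _ 1, blockMap_blockBase]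

/-- `b0Z M c` belongs to the corridor of `c`. [folklore] -/
theorem b0Z_mem_corr {M : ℕ} (hM : 0 < M) (c : ZdEdge d) : b0Z M c ∈ corr (blockMap M) eZ eZ c :=
  ⟨blockMap_b0Z_fst hM c, blockMap_b0Z_snd hM c⟩

/-- **WELL-DEFINEDNESS OF THE PRINTED `b₀(c)` ON `ℤᵈ`**: the only bond of the contour `blockLine M c` whose final
point lies in `B(c₊)` (a fortiori the only one in the corridor) is `b0Z M c`. [folklore] -/
theorem eq_b0Z_of_mem_blockLine {M : ℕ} (hM : 0 < M) {c e : ZdEdge d} (he : e ∈ blockLine M c)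
    (hend : blockMap M (e.1 + eZ e.2) = c.1 + eZ c.2) : e = b0Z M c := by
  obtain ⟨t, ht, rfl⟩ := (mem_blockLine_iff M).1 he
  have key : t + 1 = M := by
    by_contra hne
    have hlt : t + 1 < M := by omega
    have h1 : blockMap M (blockBase M c.1 + Pi.single c.2 (t : ℤ) + eZ c.2) = c.1 := by
      rw [add_assoc, eZ, ← Pi.single_add]
      refine blockMap_blockBase_add_of_lt M c.1 _ (fun i => ?_) (fun i => ?_)
      · by_cases hi : i = c.2
        · subst hi; simp only [Pi.single_eq_same]; omega
        · simp only [Pi.single_eq_of_ne hi]; rfl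
      · by_cases hi : i = c.2
        · subst hi; simp only [Pi.single_eq_same]; omega
        · simp only [Pi.single_eq_of_ne hi]; exact_mod_cast hM
    have h2 := (h1.symm.trans hend)
    have := congrFun h2 c.2
    simp at this
  have : (t : ℤ) = (M : ℤ) - 1 := by omega
  simp only [b0Z, this]

/-- Existence and uniqueness together: the bonds of `blockLine M c` in the corridor of `c` are exactly `{b0Z M c}`.
[folklore] -/
theorem mem_blockLine_and_mem_corr_iff {M : ℕ} (hM : 0 < M) {c e : ZdEdge d} :
    (e ∈ blockLine M c ∧ e ∈ corr (blockMap M) eZ eZ c) ↔ e = b0Z M c :=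
  ⟨fun h => eq_b0Z_of_mem_blockLine hM h.1 h.2.2, fun h => h ▸ ⟨b0Z_mem_blockLine hM c, b0Z_mem_corr hM c⟩⟩

/-- **The dependence set on `ℤᵈ` IS `B7BlockGeometry.qppBonds M c`** (the index set *"b ⊂ Bᵏ(c₋) ∪ Bᵏ(c₊)"* of
[B7] (140)–(141)). [folklore] -/
theorem mem_depSet_iff_mem_qppBonds {M : ℕ} [NeZero M] {c b : ZdEdge d} :
    b ∈ depSet (blockMap M) eZ eZ c ↔ b ∈ qppBonds M c := by
  rw [mem_qppBonds, mem_twoBlocks_iff, mem_twoBlocks_iff, mem_depSet]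

/-- As sets: `depSet (blockMap M) e e c = ↑(qppBonds M c)`. [folklore] -/
theorem depSet_eq_coe_qppBonds {M : ℕ} [NeZero M] (c : ZdEdge d) :
    depSet (blockMap M) eZ eZ c = ↑(qppBonds M c) :=
  Set.ext fun _ => mem_depSet_iff_mem_qppBonds.trans Finset.mem_coe.symm

/-- **SEPARATION ON `ℤᵈ`**: `b₀(c′) ⊂ B(c₋) ∪ B(c₊) ⇒ c′ = c` (every ratio `M ≥ 1`, every `d`). [folklore] -/
theorem eq_of_b0Z_mem_qppBonds {M : ℕ} (hM : 0 < M) {c c' : ZdEdge d} (h : b0Z M c' ∈ qppBonds M c) : c' = c := by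
  haveI : NeZero M := ⟨hM.ne'⟩
  exact eq_of_b0_mem_depSet separating_single (b0Z_mem_corr hM) (mem_depSet_iff_mem_qppBonds.2 h)

/-- `b0Z M c ⊂ B(c₋) ∪ B(c₊)`. [folklore] -/
theorem b0Z_mem_qppBonds {M : ℕ} (hM : 0 < M) (c : ZdEdge d) : b0Z M c ∈ qppBonds M c := by
  haveI : NeZero M := ⟨hM.ne'⟩
  exact mem_depSet_iff_mem_qppBonds.1 (b0_mem_depSet (b0Z_mem_corr hM) c)

/-- `b0Z M` is injective. [folklore] -/
theorem b0Z_injective {M : ℕ} (hM : 0 < M) : Function.Injective (b0Z (d := d) M) :=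
  injective_of_mem_corr separating_single (b0Z_mem_corr hM)

/-- **The `hsep` shape on `ℤᵈ`** with `N c := ↑(qppBonds M c)`. [folklore] -/
theorem b0Z_not_mem_qppBonds_of_ne {M : ℕ} (hM : 0 < M) :
    ∀ c c' : ZdEdge d, c ≠ c' → b0Z M c' ∉ (↑(qppBonds M c) : Set (ZdEdge d)) := by
  haveI : NeZero M := ⟨hM.ne'⟩
  intro c c' hcc' h
  exact not_mem_depSet_of_ne separating_single (b0Z_mem_corr hM) c c' hcc' (mem_depSet_iff_mem_qppBonds.2 h)

end Zd

/-! ## §4  Discharge: the locality theorems of `B13PkLocalTerms` §1b and `B10Eq20Locality` on the two geometries -/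

section DischargeTorus

variable {d n m : ℕ} [NeZero m] {X : Type*} [AddCommGroup X]

/-- **[I] p. 267 locality on the torus** (`B13PkLocalTerms.isLocalIn_fpMap` with `hb`, `hsep` discharged): if
`C̃(A)(c)` depends on `A` only on the bonds `⊂ B(c₋) ∪ B(c₊)` ([B7] Prop. 4), then `D ↦ C̃(B − hD)` is local.
[cite: Balaban1987RG1, p.267] -/
theorem isLocalIn_fpMap_torus (L h : ℕ) (hn : n = L * m) (hh : h < L) (hm : 2 < m)
    (hop : Bond (Fin d → ZMod m) d → X → X)
    {Ct : (Bond (Fin d → ZMod n) d → X) → Bond (Fin d → ZMod m) d → X}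
    (hCt : ∀ A A' c, (∀ b ∈ depSet (blk (n := n) L m h) (fUnit n) (cUnit m) c, A b = A' b) → Ct A c = Ct A' c) :
    B13PkLocalTerms.IsLocalIn (B13PkLocalTerms.fpMap (b0 L n h) hop Ct) :=
  B13PkLocalTerms.isLocalIn_fpMap (torus_b0_injective L h hn hh) (torus_b0_not_mem_depSet_of_ne L h hn hh hm) hCt

/-- **[B10] p. 260 «D̃(A, c) … depends on A restricted to B(c₋) ∪ B(c₊)» on the torus, for THE fixed point**
(`B13PkLocalTerms.fixedPt_fpMap_apply_eq` with `hb`, `hsep` discharged; existence / uniqueness of the fixed point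
are the printed inputs `hfix`, `huniq`). [cite: Balaban1985UV3, p.260] -/
theorem fixedPt_fpMap_apply_eq_torus (L h : ℕ) (hn : n = L * m) (hh : h < L) (hm : 2 < m)
    {hop : Bond (Fin d → ZMod m) d → X → X}
    {Ct : (Bond (Fin d → ZMod n) d → X) → Bond (Fin d → ZMod m) d → X}
    (hCt : ∀ A A' c, (∀ b ∈ depSet (blk (n := n) L m h) (fUnit n) (cUnit m) c, A b = A' b) → Ct A c = Ct A' c)
    {Dt : (Bond (Fin d → ZMod n) d → X) → Bond (Fin d → ZMod m) d → X}
    (hfix : ∀ B, Function.IsFixedPt (B13PkLocalTerms.fpMap (b0 L n h) hop Ct B) (Dt B))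
    (huniq : ∀ B D, Function.IsFixedPt (B13PkLocalTerms.fpMap (b0 L n h) hop Ct B) D → D = Dt B)
    {B B' : Bond (Fin d → ZMod n) d → X} {c : Bond (Fin d → ZMod m) d}
    (hBB' : ∀ b ∈ depSet (blk (n := n) L m h) (fUnit n) (cUnit m) c, B b = B' b) : Dt B c = Dt B' c :=
  B13PkLocalTerms.fixedPt_fpMap_apply_eq (torus_b0_injective L h hn hh)
    (torus_b0_not_mem_depSet_of_ne L h hn hh hm) hCt hfix huniq hBB'

/-- **(Loc) of `B10Eq20Locality` on the torus from the printed dependence-set form** (`isCoarseLocal_of_dependsOn`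
with `hsep` discharged). [cite: Balaban1985UV3, p.260] -/
theorem isCoarseLocal_of_dependsOn_torus (L h : ℕ) (hn : n = L * m) (hh : h < L) (hm : 2 < m)
    {𝒟 : (Bond (Fin d → ZMod n) d → X) → (Bond (Fin d → ZMod n) d → X)}
    (hN : ∀ A A' c, (∀ b ∈ depSet (blk (n := n) L m h) (fUnit n) (cUnit m) c, A b = A' b) →
      𝒟 A (b0 L n h c) = 𝒟 A' (b0 L n h c)) :
    B10Eq20Locality.IsCoarseLocal (b0 (m := m) L n h) 𝒟 :=
  B10Eq20Locality.isCoarseLocal_of_dependsOn hN (torus_b0_not_mem_depSet_of_ne L h hn hh hm)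

variable [NeZero n]

open B10Eq20Locality (coarseBlock jac) in
/-- **[B10] (20) on the torus for THE solution of (17) / [I] p. 267** (`B10Eq20Locality.eq20_of_fixedPt` with `hb`,
`hsep` discharged): with `C̃` local on `B(c₋) ∪ B(c₊)`, `D̃ A` the unique fixed point of `X ↦ C̃(A − hX)` and `L` a
Fréchet derivative of `A ↦ hD̃(A)`, `det(I − L) = Π_c det(1 − J_c)`. [cite: Balaban1985UV3, (20) p.261] -/
theorem eq20_of_fixedPt_torus {𝕜 : Type*} [NontriviallyNormedField 𝕜] {ι : Type*} [Fintype ι] [DecidableEq ι]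
    (L h : ℕ) (hn : n = L * m) (hh : h < L) (hm : 2 < m)
    {hop : Bond (Fin d → ZMod m) d → (ι → 𝕜) → (ι → 𝕜)}
    {Ct : (Bond (Fin d → ZMod n) d → ι → 𝕜) → Bond (Fin d → ZMod m) d → (ι → 𝕜)}
    (hCt : ∀ A A' c, (∀ b ∈ depSet (blk (n := n) L m h) (fUnit n) (cUnit m) c, A b = A' b) → Ct A c = Ct A' c)
    {Dt : (Bond (Fin d → ZMod n) d → ι → 𝕜) → Bond (Fin d → ZMod m) d → (ι → 𝕜)}
    (hfix : ∀ B, Function.IsFixedPt (B13PkLocalTerms.fpMap (b0 L n h) hop Ct B) (Dt B))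
    (huniq : ∀ B D, Function.IsFixedPt (B13PkLocalTerms.fpMap (b0 L n h) hop Ct B) D → D = Dt B)
    {A : Bond (Fin d → ZMod n) d → ι → 𝕜}
    {Lop : (Bond (Fin d → ZMod n) d → ι → 𝕜) →L[𝕜] (Bond (Fin d → ZMod n) d → ι → 𝕜)}
    (hL : HasFDerivAt (fun A => B13PkLocalTerms.hOp (b0 L n h) hop (Dt A)) Lop A) :
    LinearMap.det (LinearMap.id -
        (Lop : (Bond (Fin d → ZMod n) d → ι → 𝕜) →ₗ[𝕜] (Bond (Fin d → ZMod n) d → ι → 𝕜)))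
      = ∏ c, (1 - coarseBlock (b0 (m := m) L n h)
          (jac (Lop : (Bond (Fin d → ZMod n) d → ι → 𝕜) →ₗ[𝕜] (Bond (Fin d → ZMod n) d → ι → 𝕜))) c).det :=
  B10Eq20Locality.eq20_of_fixedPt (torus_b0_injective L h hn hh) (torus_b0_not_mem_depSet_of_ne L h hn hh hm)
    hCt hfix huniq hL

end DischargeTorus

section DischargeZd

open Literature.MathematicalPhysics.QuantumLattice (ZdEdge)
open B7BlockGeometry (qppBonds)

variable {d : ℕ} {X : Type*} [AddCommGroup X]

/-- **[I] p. 267 locality on `ℤᵈ`** (`B13PkLocalTerms.isLocalIn_fpMap`, `hb` / `hsep` discharged, `N c` = the bonds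
`⊂ B(c₋) ∪ B(c₊)` = `qppBonds M c`). [cite: Balaban1987RG1, p.267] -/
theorem isLocalIn_fpMap_zd {M : ℕ} (hM : 0 < M) (hop : ZdEdge d → X → X)
    {Ct : (ZdEdge d → X) → ZdEdge d → X}
    (hCt : ∀ A A' c, (∀ b ∈ qppBonds M c, A b = A' b) → Ct A c = Ct A' c) :
    B13PkLocalTerms.IsLocalIn (B13PkLocalTerms.fpMap (b0Z M) hop Ct) :=
  B13PkLocalTerms.isLocalIn_fpMap (N := fun c => ↑(qppBonds M c)) (b0Z_injective hM)
    (b0Z_not_mem_qppBonds_of_ne hM) fun A A' c hAA' => hCt A A' c fun b hb => hAA' b (Finset.mem_coe.2 hb)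

/-- **[B10] p. 260 dependence of THE fixed point on `A|B(c₋) ∪ B(c₊)`, on `ℤᵈ`** (`fixedPt_fpMap_apply_eq`, `hb` /
`hsep` discharged). [cite: Balaban1985UV3, p.260] -/
theorem fixedPt_fpMap_apply_eq_zd {M : ℕ} (hM : 0 < M) {hop : ZdEdge d → X → X}
    {Ct : (ZdEdge d → X) → ZdEdge d → X}
    (hCt : ∀ A A' c, (∀ b ∈ qppBonds M c, A b = A' b) → Ct A c = Ct A' c)
    {Dt : (ZdEdge d → X) → ZdEdge d → X}
    (hfix : ∀ B, Function.IsFixedPt (B13PkLocalTerms.fpMap (b0Z M) hop Ct B) (Dt B))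
    (huniq : ∀ B D, Function.IsFixedPt (B13PkLocalTerms.fpMap (b0Z M) hop Ct B) D → D = Dt B)
    {B B' : ZdEdge d → X} {c : ZdEdge d} (hBB' : ∀ b ∈ qppBonds M c, B b = B' b) : Dt B c = Dt B' c :=
  B13PkLocalTerms.fixedPt_fpMap_apply_eq (N := fun c => ↑(qppBonds M c)) (b0Z_injective hM)
    (b0Z_not_mem_qppBonds_of_ne hM) (fun A A' c hAA' => hCt A A' c fun b hb => hAA' b (Finset.mem_coe.2 hb))
    hfix huniq fun b hb => hBB' b (Finset.mem_coe.1 hb)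

/-- **(Loc) of `B10Eq20Locality` on `ℤᵈ` from the printed dependence-set form** (`isCoarseLocal_of_dependsOn`,
`hsep` discharged). [cite: Balaban1985UV3, p.260] -/
theorem isCoarseLocal_of_dependsOn_zd {M : ℕ} (hM : 0 < M)
    {𝒟 : (ZdEdge d → X) → (ZdEdge d → X)}
    (hN : ∀ A A' c, (∀ b ∈ qppBonds M c, A b = A' b) → 𝒟 A (b0Z M c) = 𝒟 A' (b0Z M c)) :
    B10Eq20Locality.IsCoarseLocal (b0Z M) 𝒟 :=
  B10Eq20Locality.isCoarseLocal_of_dependsOn (N := fun c => ↑(qppBonds M c))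
    (fun A A' c hAA' => hN A A' c fun b hb => hAA' b (Finset.mem_coe.2 hb)) (b0Z_not_mem_qppBonds_of_ne hM)

end DischargeZd

/-! ## §5  Sanity instances -/

section Examples

open Literature.MathematicalPhysics.QuantumLattice (ZdEdge)
open B7BlockGeometry (qppBonds)

/-- `d = 1`, `M = 3`: `b₀(⟨0, 1⟩) = (2, 0)`, the bond `⟨2, 3⟩` crossing from `B(0) = {0, 1, 2}` into `B(1) = {3, 4, 5}`.
[folklore] -/
example : b0Z (d := 1) 3 (fun _ => 0, 0) = (fun _ => 2, 0) := by
  refine Prod.ext ?_ rfl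
  funext i
  fin_cases i
  simp [b0Z, Literature.MathematicalPhysics.QuantumLattice.blockBase]

/-- The torus with `m = 3` coarse sites per direction separates (smallest admissible case of §2), e.g. `d = 4`,
`L = 13`, `h = 6`, `n = 39`. [folklore] -/
example : ∀ c c' : Bond (Fin 4 → ZMod 3) 4, c ≠ c' →
    b0 13 39 6 c' ∉ depSet (blk (n := 39) 13 3 6) (fUnit 39) (cUnit 3) c :=
  torus_b0_not_mem_depSet_of_ne 13 6 (by norm_num) (by norm_num) (by norm_num)

end Examples

end B13CorridorSeparation

end Literature.MathematicalPhysics.QuantumFieldTheory.Balaban1983to89
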